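import Summits.NavierStokesRegularity.NavierStokesRegularity.Theses.TypeILiouville
import Literature.Analysis.FluidPDE.OseenBallAverageMomentum
import Literature.Analysis.FluidPDE.NSBoundedMildOseenDuhamel
import Literature.Analysis.FluidPDE.KNSSRemark61
import Literature.Analysis.UnboundedOperators.HeatKernelBoundedData
import Mathlib.MeasureTheory.Integral.Average
import HarnessLib

/-!
# Stub `stub_oseen_ball_average_momentum` (crux `TypeIliouvilleL`, stmt-NavierStokesRegularity-10661,
# line `registered`): conservation of momentum at spatial infinity, ball-average form

Helper file (lands `--supports stmt-NavierStokesRegularity-10661`; theorems only, no definitions,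
no named facts). For a jointly measurable field `V` on `ℝ × ℝ³` bounded by `N` on `[s, t] × ℝ³`
(`s < t`), the ball averages over `B_R = ball 0 R` of the caloric increment
`e^{(t−s)Δ}V(s) − V(s)` and of the Oseen–Duhamel term `B¹_s(V,V)(t) = oseenDuhamel 1 s V V t`
tend to `0` as `R → ∞` (`stub_oseen_ball_average_momentum`). Consequently a bounded solution of
the Oseen integral equation `V(t) = e^{(t−s)Δ}V(s) − B¹_s(V,V)(t)` has `⨍_{B_R} (V(t) − V(s)) → 0`:
its mean at spatial infinity is conserved (Koch–Nadirashvili–Seregin–Šverák 2009, §4: the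
Duhamel term `B` only involves spatial derivatives of `u ⊗ u`).

## Proof

The two generic limits are the tree theorems
`Literature.Analysis.FluidPDE.tendsto_setAverage_heatExtension_sub` (heat part: Fubini against
the heat kernel, the `L¹` translation modulus `∫ |1_{B_R}(u + z) − 1_{B_R}(u)| du ≤
min(2, 8‖z‖/R)|B_R|` in dimension `3`, dominated convergence) and
`Literature.Analysis.FluidPDE.tendsto_setAverage_oseenDuhamel` (Oseen part: Fubini over
`B_R × ((s,t) × ℝ³)`, `∫ K = 0` for the Oseen kernel, Koch–Tataru's bound (14), Tonelli, and
dominated convergence in time against `(t − τ)^{-1/2}`), stated on a finite-dimensional inner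
product space of dimension `3` (`OseenBallAverageMomentum.lean`). Here they are specialised to
`ℝ³ = EuclideanSpace ℝ (Fin 3)` (`finrank_euclideanSpace_fin`) and subtracted; the split of the
average `⨍_{B_R} (A − g − D) = ⨍_{B_R} (A − g) − ⨍_{B_R} D` uses the integrability of both pieces
on the ball (`aestronglyMeasurable_heatExtension_of_aestronglyMeasurable`, `norm_heatExtension_le`,
`aestronglyMeasurable_oseenDuhamel`, `exists_norm_oseenDuhamel_bounded_le`).

## References

* G. Koch, N. Nadirashvili, G. Seregin, V. Šverák, *Liouville theorems for the Navier–Stokes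
  equations and applications*, Acta Math. 203 (2009) 83–105 = arXiv:0709.3599, §4 p. 8 (the
  bilinear form `B`, mild bounded ancient solutions). [KochNadirashviliSereginSverak2009]
* H. Koch, D. Tataru, *Well-posedness for the Navier–Stokes equations*, Adv. Math. 157 (2001),
  §2 (8), §3 (14). [KochTataruAdvMath2001]
-/

-- the summit and its single problem share the name (D-0017 nested layout)
set_option linter.dupNamespace false

noncomputable section

namespace Summit.NavierStokesRegularity.NavierStokesRegularity.Theorems

open MeasureTheory Filter Set Function Metric
open scoped Topology ENNReal
open Literature.Analysis Literature.Analysis.FluidPDE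

/-- **Stub C (conservation of momentum at spatial infinity, ball-average form).** For a jointly
measurable field `V` bounded by `N` on `[s, t] × ℝ³` (`s < t`), the ball averages of the caloric
increment `e^{(t−s)Δ}V(s) − V(s)` and of the Duhamel term `B¹_s(V,V)(t)` tend to `0` as the
radius tends to `∞`:
`⨍_{B_R} (e^{(t−s)Δ}V(s) − V(s) − B¹_s(V,V)(t)) → 0`. Both are `∫ k(z) (…) dz` against `L¹`
kernels — the heat kernel, resp. the Oseen kernel with `‖K(τ,z)‖ ≲ (τ + ‖z‖²)^{-2}`
(`exists_norm_oseenKernel_le`) and `∫ K = 0` (`integral_oseenKernel_eq_zero`) — averaged over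
`B_R`, and `∫ |1_{B_R}(u + z) − 1_{B_R}(u)| du ≤ min(2, 8‖z‖/R)|B_R|`
(`Literature.Analysis.FluidPDE.lintegral_enorm_indicator_ball_add_sub_le`); dominated
convergence, the time integral being dominated by `(t − τ)^{-1/2}`. Consequently an Oseen-mild
bounded field has `⨍_{B_R} (V(t) − V(s)) → 0`: its mean at infinity does not move
(Koch–Nadirashvili–Seregin–Šverák 2009, §4). [cite: KochNadirashviliSereginSverak2009, §4 p. 8 (the bilinear form B; mild bounded ancient solutions) (arXiv:0709.3599)] -/
theorem stub_oseen_ball_average_momentum :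
    ∀ (V : ℝ → EuclideanSpace ℝ (Fin 3) → EuclideanSpace ℝ (Fin 3)) (N s t : ℝ), s < t →
      Measurable (uncurry V) →
      (∀ σ ∈ Icc s t, ∀ y, ‖V σ y‖ ≤ N) →
      Tendsto (fun R : ℝ => ⨍ x in Metric.ball (0 : EuclideanSpace ℝ (Fin 3)) R,
        (Literature.Analysis.UnboundedOperators.heatExtension (V s) (t - s) x - V s x -
          Literature.Analysis.FluidPDE.oseenDuhamel 1 s V V t x)) atTop (𝓝 0) := by
  intro V N s t hst hV hN
  have hd : Module.finrank ℝ (EuclideanSpace ℝ (Fin 3)) = 3 := finrank_euclideanSpace_fin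
  have hVs : Measurable (V s) := hV.comp measurable_prodMk_left
  have hNs : ∀ y, ‖V s y‖ ≤ N := hN s (left_mem_Icc.2 hst.le)
  have hN0 : 0 ≤ N := (norm_nonneg _).trans (hNs 0)
  have hNo : ∀ τ ∈ Ioo s t, ∀ y, ‖V τ y‖ ≤ N := fun τ hτ y => hN τ (Ioo_subset_Icc_self hτ) y
  obtain ⟨C, -, hC⟩ := exists_norm_oseenDuhamel_bounded_le (E := EuclideanSpace ℝ (Fin 3))
  have h := (tendsto_setAverage_heatExtension_sub hd hVs hNs
    (sub_pos.2 hst)).sub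
    (tendsto_setAverage_oseenDuhamel hd hV hst hN)
  rw [sub_zero] at h
  refine h.congr fun R => ?_
  have hAi : Integrable (fun x => UnboundedOperators.heatExtension (V s) (t - s) x - V s x)
      ((volume : Measure (EuclideanSpace ℝ (Fin 3))).restrict (ball 0 R)) :=
    Measure.integrableOn_of_bounded (M := N + N) measure_ball_lt_top.ne
      ((aestronglyMeasurable_heatExtension_of_aestronglyMeasurable hVs.aestronglyMeasurable
        _).sub hVs.aestronglyMeasurable)
      (ae_of_all _ fun x => (norm_sub_le _ _).trans (add_le_add
        (UnboundedOperators.norm_heatExtension_le hNs (sub_pos.2 hst) x) (hNs x)))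
  have hDi : Integrable (oseenDuhamel 1 s V V t)
      ((volume : Measure (EuclideanSpace ℝ (Fin 3))).restrict (ball 0 R)) :=
    Measure.integrableOn_of_bounded measure_ball_lt_top.ne
      (aestronglyMeasurable_oseenDuhamel one_pos hV.aestronglyMeasurable hV.aestronglyMeasurable
        hN0 hNo hNo hst le_rfl)
      (ae_of_all _ fun x => hC one_pos hst hN0 hNo hNo x)
  rw [setAverage_eq, setAverage_eq, setAverage_eq, integral_sub hAi hDi, smul_sub]


end Summit.NavierStokesRegularity.NavierStokesRegularity.Theorems

end
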